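import Summits.SmoothPoincare4.SmoothPoincare4.Theorems.ConvexBisectionAcyclicBisectionExistsStabilisationData
import HarnessLib

/-!
# N3 (`stub_STgeo`) ▸ N3-nat: BOOKKEEPING OF THE NATURAL STABILISED WORD `natWord g c l`
(wave 7, brick H6-6 of stub `stub_STgeo` = node N3 of NF4, line `modp-braid-orbits`, crux
`ConvexBisection.AcyclicBisectionExists`, item stmt-SmoothPoincare4-10508; registered sub-goal
`helper_natWord_getElem_add_four`; vocabulary `…StabilisationData.lean` (H6-1).)

The letters of `natWord g c l = (a,+)(a,−)(b,+)(b,−) ++ mapWord (embed g) l` (`a = newE g + embed g c`,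
`b = newF g`) by position, in the `getElem` form in which `IsLefschetzLink (g+1) (natWord g c l) h''`
(`mem_page` at `pageDir (l.length + 4) i`, `shadow_eq`/`twisting_eq` at `(natWord g c l).get i`) is
checked by the finishing piece N3d-6 — the companion of G5's §3 of `…StabBlockMoves.lean` (which does the
same for the REGISTERED order `stabBlock g c ++ …`).  Everything is `rfl`/`simp`; no definitions.
References: R. İ. Baykur, AGT 6 (2006), Lemma 1 [Baykur2006].
-/

noncomputable section

-- the prescribed namespace `Summit.<P>.<Sub>.…` duplicates `SmoothPoincare4` (P = Sub)
set_option linter.dupNamespace false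

open Set Function

namespace Summit.SmoothPoincare4.SmoothPoincare4.Theorems.AcyclicBisectionExists.ModpBraidOrbits

open Literature.GroupTheory.CombinatorialGroupTheory.SignedHurwitz

namespace StabilisationData

variable {g : ℕ}

/-- Letter `0` of the natural word is `(a, +)`. [folklore] -/
theorem getElem_natWord_zero (c : Fin g ⊕ Fin g → ℤ) (l : IntWord g) (h : 0 < (natWord g c l).length) :
    (natWord g c l)[0]'h = (newE g + embed g c, true) := rfl

/-- Letter `1` of the natural word is `(a, −)`. [folklore] -/
theorem getElem_natWord_one (c : Fin g ⊕ Fin g → ℤ) (l : IntWord g) (h : 1 < (natWord g c l).length) :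
    (natWord g c l)[1]'h = (newE g + embed g c, false) := rfl

/-- Letter `2` of the natural word is `(b, +)`. [folklore] -/
theorem getElem_natWord_two (c : Fin g ⊕ Fin g → ℤ) (l : IntWord g) (h : 2 < (natWord g c l).length) :
    (natWord g c l)[2]'h = (newF g, true) := rfl

/-- Letter `3` of the natural word is `(b, −)`. [folklore] -/
theorem getElem_natWord_three (c : Fin g ⊕ Fin g → ℤ) (l : IntWord g) (h : 3 < (natWord g c l).length) :
    (natWord g c l)[3]'h = (newF g, false) := rfl

/-- The natural word is the four-letter natural block followed by the embedded old word. [folklore] -/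
theorem natWord_eq_append (c : Fin g ⊕ Fin g → ℤ) (l : IntWord g) :
    natWord g c l = [(newE g + embed g c, true), (newE g + embed g c, false), (newF g, true), (newF g, false)] ++
      mapWord (embed g) l := rfl

/-- **Letter `k + 4` of the natural word is the embedded `k`-th old letter (same sign).** [folklore] -/
theorem getElem_natWord_add_four (c : Fin g ⊕ Fin g → ℤ) (l : IntWord g) (k : ℕ) (hk : k < l.length)
    (h : k + 4 < (natWord g c l).length) :
    (natWord g c l)[k + 4]'h = (embed g (l[k]'hk).1, (l[k]'hk).2) := by
  simp only [natWord_eq_append]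
  rw [List.getElem_append_right (by simp)]
  simp [mapWord]

/-- The class of letter `k + 4` of the natural word is `embed` of the old class `k`. [folklore] -/
theorem getElem_natWord_add_four_fst (c : Fin g ⊕ Fin g → ℤ) (l : IntWord g) (k : ℕ) (hk : k < l.length)
    (h : k + 4 < (natWord g c l).length) :
    ((natWord g c l)[k + 4]'h).1 = embed g (l[k]'hk).1 := by
  rw [getElem_natWord_add_four c l k hk h]

/-- The sign of letter `k + 4` of the natural word is the sign of the old letter `k`. [folklore] -/
theorem getElem_natWord_add_four_snd (c : Fin g ⊕ Fin g → ℤ) (l : IntWord g) (k : ℕ) (hk : k < l.length)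
    (h : k + 4 < (natWord g c l).length) :
    ((natWord g c l)[k + 4]'h).2 = (l[k]'hk).2 := by
  rw [getElem_natWord_add_four c l k hk h]

/-- The classes of the four block letters: `a` at positions `0, 1`, `b` at positions `2, 3`. [folklore] -/
theorem getElem_natWord_fst_of_lt_four (c : Fin g ⊕ Fin g → ℤ) (l : IntWord g) {i : ℕ} (hi : i < 4)
    (h : i < (natWord g c l).length) :
    ((natWord g c l)[i]'h).1 = if i < 2 then newE g + embed g c else newF g := by
  have : i = 0 ∨ i = 1 ∨ i = 2 ∨ i = 3 := by omega
  rcases this with rfl | rfl | rfl | rfl <;> rfl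

/-- The signs of the four block letters: `+` at the even positions `0, 2`, `−` at the odd positions `1, 3`.
[folklore] -/
theorem getElem_natWord_snd_of_lt_four (c : Fin g ⊕ Fin g → ℤ) (l : IntWord g) {i : ℕ} (hi : i < 4)
    (h : i < (natWord g c l).length) :
    ((natWord g c l)[i]'h).2 = decide (i % 2 = 0) := by
  have : i = 0 ∨ i = 1 ∨ i = 2 ∨ i = 3 := by omega
  rcases this with rfl | rfl | rfl | rfl <;> rfl

/-- `List.get` form: the `Fin`-indexed letter of the natural word at an old position. [folklore] -/
theorem get_natWord_add_four (c : Fin g ⊕ Fin g → ℤ) (l : IntWord g) (k : Fin l.length)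
    (h : (k : ℕ) + 4 < (natWord g c l).length) :
    (natWord g c l).get ⟨(k : ℕ) + 4, h⟩ = (embed g (l.get k).1, (l.get k).2) := by
  simp only [List.get_eq_getElem]
  exact getElem_natWord_add_four c l k k.2 h

end StabilisationData

/-! ## Registered helper -/

/-- **Registered helper `helper_natWord_getElem_add_four` (sub-goal of `stub_STgeo` ▸ N3-nat ▸ N3d-6
bookkeeping, wave 7, lead c5): letter `k + 4` of the natural stabilised word is the embedded old letter `k`
with its sign.** [folklore] -/
theorem helper_natWord_getElem_add_four : ∀ (g : ℕ) (c : Fin g ⊕ Fin g → ℤ) (l : Literature.GroupTheory.CombinatorialGroupTheory.SignedHurwitz.IntWord g) (k : ℕ) (hk : k < l.length) (h : k + 4 < (Summit.SmoothPoincare4.SmoothPoincare4.Theorems.AcyclicBisectionExists.ModpBraidOrbits.natWord g c l).length), (Summit.SmoothPoincare4.SmoothPoincare4.Theorems.AcyclicBisectionExists.ModpBraidOrbits.natWord g c l)[k + 4]'h = (Literature.GroupTheory.CombinatorialGroupTheory.SignedHurwitz.embed g (l[k]'hk).1, (l[k]'hk).2) :=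
  fun _ c l k hk h => StabilisationData.getElem_natWord_add_four c l k hk h

end Summit.SmoothPoincare4.SmoothPoincare4.Theorems.AcyclicBisectionExists.ModpBraidOrbits

end
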